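import Mathlib
import Literature.Computability.AlgebraicComplexity.TraceGadgetTrace
import Literature.Computability.AlgebraicComplexity.LaurentPolyOrder
import Literature.Computability.AlgebraicComplexity.NonscalarBaurStrassen
import HarnessLib

/-!
# From a border nonscalar computation of `tr(XYZ)` to the border rank of `⟨t,t,t⟩`

Topic `Literature/Computability/AlgebraicComplexity`. Support file for the formalisation of
R. Andrews, *On Matrix Multiplication and Polynomial Identity Testing* (FOCS 2022,
arXiv:2208.01078), Theorem 3 (`DeterminantalIdealComplexity.lean`, fact `Andrews2022_thm3`):
the SECOND HALF of the printed proof of Theorem 3, i.e. everything after Proposition 2: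

> Applying Proposition 2 to the circuit `Φ` yields a circuit `Ψ` of multiplicative complexity `s`
> that computes `tr(XYZ) + O(ε)`. We then apply Lemma 2 [Baur–Strassen] to `Ψ` to obtain a
> circuit of multiplicative complexity `3s` that simultaneously computes all first-order partial
> derivatives of `tr(XYZ) + O(ε)`. Observe that the partial derivative of `tr(XYZ)` with respect
> to `z_{j,i}` is, up to the `O(ε)` error term, the `(i,j)` entry of the matrix product `XY`. Thus,
> we have a circuit of multiplicative complexity `3s` that approximates the product of two
> `r/4 × r/4` matrices. By Lemma 7, this implies that the border rank of `r/4 × r/4 × r/4` matrix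
> multiplication is bounded from above by `6s`.

in the currency of the support files already in the tree: nonscalar computation sequences over
the Laurent series field `F((ε))` (`NonscalarComputation`), the Baur–Strassen derivative
inequality (`NonscalarBaurStrassen`), Lemma 7 (`NonscalarBorderRank`), the polynomial `tr(XYZ)`
of the trace gadget (`TraceGadgetTrace`) and `O(ε^k)` bookkeeping (`LaurentPolyOrder`).

## Content

* `TraceGadget.rowXY t κ ν = Σ_μ x_{κμ} y_{μν}` — the `(κ, ν)` entry of `XY`;
  `TraceGadget.pderiv_z_traceXYZ` — `∂ tr(XYZ) / ∂ z_{νκ} = (XY)_{κν}`;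
  `TraceGadget.coeff_xy_rowXY` — its bilinear coefficient tensor is the matrix multiplication
  tensor `⟨t,t,t⟩` (`matMulTensor`, Bläser's indexing: output `(κ,ν)`, `x_{κμ}`, `y_{μν}`).
* `algBorderRank_matMulTensor_le_of_traceXYZ` — **the step**: if some `p = tr(XYZ) + O(ε)` lies in
  the cost-free span of a nonscalar computation sequence over `F((ε))` of length `≤ N`, then
  `bR(⟨t,t,t⟩) ≤ 6N` (algebraic border rank over `F[ε]`, `algBorderRank`).

No named facts are introduced (D-0026); everything is proved.

## References

* [Andrews2022] R. Andrews, *On Matrix Multiplication and Polynomial Identity Testing*, FOCS 2022,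
  arXiv:2208.01078, proof of Thm. 3 (with Lemma 2 = Baur–Strassen and Lemma 7).
* [BaurStrassen1983] W. Baur, V. Strassen, *The complexity of partial derivatives*, Theoret.
  Comput. Sci. 22 (1983), Thm. 1.
* [BurgisserClausenShokrollahi1997] P. Bürgisser, M. Clausen, M. A. Shokrollahi, *Algebraic
  Complexity Theory*, 1997, Thm. (7.7), Prop. (14.1).
-/

noncomputable section

open MvPolynomial

namespace Literature.Computability.AlgebraicComplexity

universe u u'

namespace TraceGadget

variable {S : Type u} [CommRing S] {t : ℕ}

variable (S t) in
/-- The `(κ, ν)` entry `Σ_μ x_{κμ} y_{μν}` of the matrix product `XY`. [cite: Andrews2022, Thm. 3 (proof)] -/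
def rowXY (κ ν : Fin t) : MvPolynomial (Var t) S :=
  ∑ μ : Fin t, X (Sum.inl (κ, μ)) * X (Sum.inr (Sum.inl (μ, ν)))

/-- **`∂ tr(XYZ) / ∂ z_{νκ} = (XY)_{κν}`** ("the partial derivative of `tr(XYZ)` with respect to
`z_{j,i}` is the `(i,j)` entry of the matrix product `XY`"). [cite: Andrews2022, Thm. 3 (proof)] -/
theorem pderiv_z_traceXYZ [NeZero t] (κ ν : Fin t) :
    pderiv (Sum.inr (Sum.inr (ν, κ))) (traceXYZ S t) = rowXY S t κ ν := by
  classical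
  have hterm : ∀ i μ ν' : Fin t,
      pderiv (Sum.inr (Sum.inr (ν, κ)))
          (X (Sum.inl (i, μ)) * X (Sum.inr (Sum.inl (μ, ν'))) * X (Sum.inr (Sum.inr (ν', i))) :
            MvPolynomial (Var t) S) =
        if ν' = ν ∧ i = κ then X (Sum.inl (i, μ)) * X (Sum.inr (Sum.inl (μ, ν'))) else 0 := by
    intro i μ ν'
    rw [pderiv_mul, pderiv_mul, pderiv_X_of_ne (by simp), pderiv_X_of_ne (by simp), pderiv_X]
    simp only [mul_zero, zero_mul, add_zero, zero_add, Pi.single_apply, Sum.inr.injEq,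
      Prod.mk.injEq]
    split_ifs <;> simp
  simp only [traceXYZ, diagXYZ, map_sum, hterm]
  -- `Σ_i Σ_μ Σ_ν' [ν' = ν ∧ i = κ] x_{iμ} y_{μν'} = Σ_μ x_{κμ} y_{μν}`
  rw [Finset.sum_eq_single κ]
  · refine Finset.sum_congr rfl fun μ _ => ?_
    rw [Finset.sum_eq_single ν]
    · simp
    · intro ν' _ hν'
      rw [if_neg (fun h => hν' h.1)]
    · simp
  · intro i _ hi
    refine Finset.sum_eq_zero fun μ _ => Finset.sum_eq_zero fun ν' _ => ?_
    rw [if_neg (fun h => hi h.2)]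
  · simp

/-- Exponents of the bilinear monomials `x_u y_v` determine `(u, v)`. [folklore] -/
theorem xyExponent_inj (u u' v v' : Fin t × Fin t) :
    ((Finsupp.single (Sum.inl u : Var t) 1 + Finsupp.single (Sum.inr (Sum.inl v)) 1 : Var t →₀ ℕ) =
        Finsupp.single (Sum.inl u') 1 + Finsupp.single (Sum.inr (Sum.inl v')) 1) ↔
      u = u' ∧ v = v' := by
  classical
  constructor
  · intro h
    have hu := DFunLike.congr_fun h (Sum.inl u)
    have hv := DFunLike.congr_fun h (Sum.inr (Sum.inl v))
    simp only [Finsupp.coe_add, Pi.add_apply, Finsupp.single_apply, Sum.inl.injEq,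
      Sum.inr.injEq, reduceCtorEq, if_true, if_false, add_zero, zero_add] at hu hv
    constructor
    · by_contra hne
      rw [if_neg (Ne.symm hne)] at hu
      exact one_ne_zero hu
    · by_contra hne
      rw [if_neg (Ne.symm hne)] at hv
      exact one_ne_zero hv
  · rintro ⟨rfl, rfl⟩
    rfl

/-- **The bilinear coefficient tensor of `XY` is `⟨t,t,t⟩`**: the coefficient of `x_a y_b` in
`(XY)_{κν}` is `1` if `a = (κ, μ)`, `b = (μ, ν)` for some `μ` and `0` otherwise, i.e. the entry
`⟨t,t,t⟩_{(κ,ν), a, b}` of the matrix multiplication tensor in Bläser's indexing (`matMulTensor`).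
[cite: Andrews2022, Thm. 3 (proof)] -/
theorem coeff_xy_rowXY (κ ν : Fin t) (a b : Fin t × Fin t) :
    coeff (Finsupp.single (Sum.inl a) 1 + Finsupp.single (Sum.inr (Sum.inl b)) 1) (rowXY S t κ ν) =
      if κ = a.1 ∧ a.2 = b.1 ∧ ν = b.2 then 1 else 0 := by
  classical
  have hmon : ∀ μ : Fin t, (X (Sum.inl (κ, μ)) * X (Sum.inr (Sum.inl (μ, ν))) :
      MvPolynomial (Var t) S) =
        monomial (Finsupp.single (Sum.inl (κ, μ)) 1 + Finsupp.single (Sum.inr (Sum.inl (μ, ν))) 1)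
          1 := by
    intro μ
    rw [X, X, monomial_mul, mul_one]
  simp only [rowXY, coeff_sum, hmon, coeff_monomial, xyExponent_inj]
  rw [Finset.sum_eq_single a.2]
  · obtain ⟨a1, a2⟩ := a
    obtain ⟨b1, b2⟩ := b
    by_cases h : κ = a1 ∧ a2 = b1 ∧ ν = b2
    · rw [if_pos h, if_pos]
      obtain ⟨rfl, rfl, rfl⟩ := h
      exact ⟨rfl, rfl⟩
    · rw [if_neg h, if_neg]
      rintro ⟨h1, h2⟩
      simp only [Prod.mk.injEq] at h1 h2
      exact h ⟨h1.1, h2.1, h2.2⟩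
  · intro μ _ hμ
    rw [if_neg]
    rintro ⟨h1, -⟩
    exact hμ (Prod.mk.inj h1).2
  · simp

end TraceGadget

/-! ### The step of the proof of Theorem 3 after Proposition 2 -/

/-- **Andrews 2022, proof of Theorem 3, second half (Baur–Strassen + Lemma 7).** Let `F` be a
field and `t ≥ 1`. If a polynomial `p ∈ F((ε))[x, y, z]` with `p = tr(XYZ) + O(ε)`
(coefficientwise) lies in the cost-free span of a nonscalar computation sequence over `F((ε))` of
length `≤ N` (a border computation of `tr(XYZ)` with `≤ N` nonscalar multiplications), then the
algebraic border rank over `F[ε]` of the matrix multiplication tensor `⟨t,t,t⟩` is at most `6N`: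
Baur–Strassen gives one sequence of length `≤ 3N` computing all `∂p/∂z_{νκ} = (XY)_{κν} + O(ε)`,
whose bilinear `x`–`y` coefficient tensor is `⟨t,t,t⟩ + O(ε)`, and Lemma 7 (`R̲ ≤ 2 C̲_×`) gives
`bR(⟨t,t,t⟩) ≤ 2 · 3N`. [cite: Andrews2022, Thm. 3 (proof), with Lemma 2 and Lemma 7] -/
theorem algBorderRank_matMulTensor_le_of_traceXYZ {F : Type u} [Field F] {t : ℕ} [NeZero t]
    {N : ℕ}
    (h : ∃ gs : List (MvPolynomial (TraceGadget.Var t) (LaurentSeries F)),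
      IsNonscalarSeq gs ∧ gs.length ≤ N ∧ ∃ p ∈ freeSpan {q | q ∈ gs},
        PolyOrdGE 1 (p - TraceGadget.traceXYZ (LaurentSeries F) t)) :
    algBorderRank (matMulTensor F t t t) ≤ 6 * N := by
  classical
  obtain ⟨gs, hgs, hlen, p, hp, hpO⟩ := h
  -- Baur–Strassen: all first-order partial derivatives with `≤ 3N` multiplications
  obtain ⟨gs', hgs', hlen', hder⟩ :=
    exists_isNonscalarSeq_forall_pderiv (s := N) (p := p) ⟨gs, hgs, hlen, hp⟩
  -- Lemma 7 applied to the family `∂p/∂z_{νκ}`, `(κ, ν) ∈ [t]²`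
  have key := algBorderRank_le_of_isNonscalarSeq_laurent (F := F) (σ := TraceGadget.Var t)
    (α := Fin t × Fin t) (β := Fin t × Fin t) (ο := Fin t × Fin t)
    Sum.inl (fun b => Sum.inr (Sum.inl b)) (fun _ _ => Sum.inl_ne_inr) (N := 3 * N)
    (fun o => pderiv (Sum.inr (Sum.inr (o.2, o.1))) p) (matMulTensor F t t t)
    ⟨gs', hgs', hlen', fun o => hder _⟩ ?_
  · calc algBorderRank (matMulTensor F t t t) ≤ 2 * (3 * N) := key
      _ = 6 * N := by ring
  · intro o a b
    set e := p - TraceGadget.traceXYZ (LaurentSeries F) t with he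
    have hp_eq : p = TraceGadget.traceXYZ (LaurentSeries F) t + e := by rw [he]; ring
    have hexact : coeff (Finsupp.single (Sum.inl a) 1 + Finsupp.single (Sum.inr (Sum.inl b)) 1)
        (pderiv (Sum.inr (Sum.inr (o.2, o.1))) (TraceGadget.traceXYZ (LaurentSeries F) t)) =
          HahnSeries.C (matMulTensor F t t t o a b) := by
      rw [TraceGadget.pderiv_z_traceXYZ, TraceGadget.coeff_xy_rowXY, matMulTensor]
      obtain ⟨o1, o2⟩ := o
      simp only
      by_cases hc : o1 = a.1 ∧ a.2 = b.1 ∧ o2 = b.2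
      · rw [if_pos hc, if_pos hc, map_one]
      · rw [if_neg hc, if_neg hc, map_zero]
    rw [hp_eq, map_add, coeff_add, hexact, add_sub_cancel_left]
    exact (hpO.pderiv _) _

end Literature.Computability.AlgebraicComplexity
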